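import Mathlib
import Summits.MatrixMultiplication.Statement
import Summits.MatrixMultiplication.MatrixMultiplication.Theses.NOFWindowCapacity

/-!
# Strategist evidence for crux `Thesis` (stmt-MatrixMultiplication-7270) — sorry-free facts

1. ONE-FULL-FACE LEMMAS (`fullFaceP_card_le`, `fullFaceQ_card_le`, `fullFaceR_card_le`): an alien-free box one of whose
   three faces is the full rectangle over its cell projections has at most `|G|` cells (generalises W1 =
   `SingleBlockBound`, which is the three-full-faces case).  Injective maps on the cells: `s i − t j + u k` (full P-face),
   `s i + t j − u k` (full Q-face), `−s i + t j + u k` (full R-face).  Stated in the route's verbatim conventions, for any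
   `AddCommGroup G` with `Fintype G` (so they apply to finite hosts; over `ℤ^d` the same injectivity bounds cells by the
   spectrum-type label counts).
2. `intSeed_singletons`: the definitions of line `integer-seed` compute — the singleton-box seed inhabits
   `IntSeed 0 N (N^3) 1 0` (cost `B·K = N³·1`, the `ε ≥ 1` regime of `stub_seedFamily`, cf. the refuter's
   `thesisBody_of_one_le`).  Definitions copied verbatim from `Lines/integer_seed.lean` into this file's namespace.
-/

set_option linter.unusedVariables false

namespace Summit.MatrixMultiplication.MatrixMultiplication.Cruxes.Thesis.IntegerSeedFacts

/-! ## 1. One-full-face lemmas -/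

section FullFace

variable {G : Type} [AddCommGroup G] [Fintype G] {N : ℕ}

/-- Full P-face: if `(x.1, y.2.2) ∈ P` for all cells `x, y` of the alien-free box `(P,Q,R)`, the box has `≤ |G|` cells. -/
theorem fullFaceP_card_le (s t u : Fin N → G) (P Q R : Finset (Fin N × Fin N))
    (hAF : ∀ a ∈ P, ∀ b ∈ Q, ∀ c ∈ R, (t b.2 - s b.1) + (u c.2 - t c.1) = u a.2 - s a.1 →
      a.1 = b.1 ∧ b.2 = c.1 ∧ a.2 = c.2)
    (hface : ∀ x y : Fin N × Fin N × Fin N,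
      ((x.1, x.2.2) ∈ P ∧ (x.1, x.2.1) ∈ Q ∧ (x.2.1, x.2.2) ∈ R) →
      ((y.1, y.2.2) ∈ P ∧ (y.1, y.2.1) ∈ Q ∧ (y.2.1, y.2.2) ∈ R) → (x.1, y.2.2) ∈ P) :
    (Finset.univ.filter (fun x : Fin N × Fin N × Fin N =>
      (x.1, x.2.2) ∈ P ∧ (x.1, x.2.1) ∈ Q ∧ (x.2.1, x.2.2) ∈ R)).card ≤ Fintype.card G := by
  classical
  rw [← Finset.card_univ (α := G)]
  apply Finset.card_le_card_of_injOn (fun x => s x.1 - t x.2.1 + u x.2.2)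
  · intro x _; exact Finset.mem_univ _
  · intro x hx y hy hxy
    simp only [Finset.coe_filter, Finset.mem_univ, true_and, Set.mem_setOf_eq] at hx hy
    have ha : (x.1, y.2.2) ∈ P := hface x y hx hy
    have heq : (t (y.1, y.2.1).2 - s (y.1, y.2.1).1) + (u (x.2.1, x.2.2).2 - t (x.2.1, x.2.2).1)
        = u (x.1, y.2.2).2 - s (x.1, y.2.2).1 := by
      have h0 : (s x.1 - t x.2.1 + u x.2.2) - (s y.1 - t y.2.1 + u y.2.2) = 0 := sub_eq_zero.mpr hxy
      refine sub_eq_zero.mp ?_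
      calc t y.2.1 - s y.1 + (u x.2.2 - t x.2.1) - (u y.2.2 - s x.1)
          = (s x.1 - t x.2.1 + u x.2.2) - (s y.1 - t y.2.1 + u y.2.2) := by abel
        _ = 0 := h0
    obtain ⟨h1, h2, h3⟩ := hAF _ ha _ hy.2.1 _ hx.2.2 heq
    simp only at h1 h2 h3
    exact Prod.ext h1 (Prod.ext h2.symm h3.symm)

/-- Full Q-face: if `(y.1, x.2.1) ∈ Q` for all cells `x, y`, the box has `≤ |G|` cells. -/
theorem fullFaceQ_card_le (s t u : Fin N → G) (P Q R : Finset (Fin N × Fin N))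
    (hAF : ∀ a ∈ P, ∀ b ∈ Q, ∀ c ∈ R, (t b.2 - s b.1) + (u c.2 - t c.1) = u a.2 - s a.1 →
      a.1 = b.1 ∧ b.2 = c.1 ∧ a.2 = c.2)
    (hface : ∀ x y : Fin N × Fin N × Fin N,
      ((x.1, x.2.2) ∈ P ∧ (x.1, x.2.1) ∈ Q ∧ (x.2.1, x.2.2) ∈ R) →
      ((y.1, y.2.2) ∈ P ∧ (y.1, y.2.1) ∈ Q ∧ (y.2.1, y.2.2) ∈ R) → (y.1, x.2.1) ∈ Q) :
    (Finset.univ.filter (fun x : Fin N × Fin N × Fin N =>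
      (x.1, x.2.2) ∈ P ∧ (x.1, x.2.1) ∈ Q ∧ (x.2.1, x.2.2) ∈ R)).card ≤ Fintype.card G := by
  classical
  rw [← Finset.card_univ (α := G)]
  apply Finset.card_le_card_of_injOn (fun x => s x.1 + t x.2.1 - u x.2.2)
  · intro x _; exact Finset.mem_univ _
  · intro x hx y hy hxy
    simp only [Finset.coe_filter, Finset.mem_univ, true_and, Set.mem_setOf_eq] at hx hy
    have hb : (y.1, x.2.1) ∈ Q := hface x y hx hy
    -- a = (x.1, x.2.2) ∈ P (cell x), b = (y.1, x.2.1) ∈ Q (face), c = (y.2.1, y.2.2) ∈ R (cell y)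
    have heq : (t (y.1, x.2.1).2 - s (y.1, x.2.1).1) + (u (y.2.1, y.2.2).2 - t (y.2.1, y.2.2).1)
        = u (x.1, x.2.2).2 - s (x.1, x.2.2).1 := by
      have h0 : (s x.1 + t x.2.1 - u x.2.2) - (s y.1 + t y.2.1 - u y.2.2) = 0 := sub_eq_zero.mpr hxy
      refine sub_eq_zero.mp ?_
      calc t x.2.1 - s y.1 + (u y.2.2 - t y.2.1) - (u x.2.2 - s x.1)
          = (s x.1 + t x.2.1 - u x.2.2) - (s y.1 + t y.2.1 - u y.2.2) := by abel
        _ = 0 := h0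
    obtain ⟨h1, h2, h3⟩ := hAF _ hx.1 _ hb _ hy.2.2 heq
    simp only at h1 h2 h3
    exact Prod.ext h1 (Prod.ext h2 h3)

/-- Full R-face: if `(x.2.1, y.2.2) ∈ R` for all cells `x, y`, the box has `≤ |G|` cells. -/
theorem fullFaceR_card_le (s t u : Fin N → G) (P Q R : Finset (Fin N × Fin N))
    (hAF : ∀ a ∈ P, ∀ b ∈ Q, ∀ c ∈ R, (t b.2 - s b.1) + (u c.2 - t c.1) = u a.2 - s a.1 →
      a.1 = b.1 ∧ b.2 = c.1 ∧ a.2 = c.2)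
    (hface : ∀ x y : Fin N × Fin N × Fin N,
      ((x.1, x.2.2) ∈ P ∧ (x.1, x.2.1) ∈ Q ∧ (x.2.1, x.2.2) ∈ R) →
      ((y.1, y.2.2) ∈ P ∧ (y.1, y.2.1) ∈ Q ∧ (y.2.1, y.2.2) ∈ R) → (x.2.1, y.2.2) ∈ R) :
    (Finset.univ.filter (fun x : Fin N × Fin N × Fin N =>
      (x.1, x.2.2) ∈ P ∧ (x.1, x.2.1) ∈ Q ∧ (x.2.1, x.2.2) ∈ R)).card ≤ Fintype.card G := by
  classical
  rw [← Finset.card_univ (α := G)]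
  apply Finset.card_le_card_of_injOn (fun x => -s x.1 + t x.2.1 + u x.2.2)
  · intro x _; exact Finset.mem_univ _
  · intro x hx y hy hxy
    simp only [Finset.coe_filter, Finset.mem_univ, true_and, Set.mem_setOf_eq] at hx hy
    have hc : (x.2.1, y.2.2) ∈ R := hface x y hx hy
    -- a = (x.1, x.2.2) ∈ P (cell x), b = (y.1, y.2.1) ∈ Q (cell y), c = (x.2.1, y.2.2) ∈ R (face)
    have heq : (t (y.1, y.2.1).2 - s (y.1, y.2.1).1) + (u (x.2.1, y.2.2).2 - t (x.2.1, y.2.2).1)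
        = u (x.1, x.2.2).2 - s (x.1, x.2.2).1 := by
      have h0 : (-s x.1 + t x.2.1 + u x.2.2) - (-s y.1 + t y.2.1 + u y.2.2) = 0 := sub_eq_zero.mpr hxy
      refine sub_eq_zero.mp ?_
      calc t y.2.1 - s y.1 + (u y.2.2 - t x.2.1) - (u x.2.2 - s x.1)
          = -((-s x.1 + t x.2.1 + u x.2.2) - (-s y.1 + t y.2.1 + u y.2.2)) := by abel
        _ = 0 := by rw [h0, neg_zero]
    obtain ⟨h1, h2, h3⟩ := hAF _ hx.1 _ hy.2.1 _ hc heq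
    simp only at h1 h2 h3
    exact Prod.ext h1 (Prod.ext h2.symm h3)

end FullFace

/-! ## 2. The definitions of line `integer-seed` (verbatim) and the singleton-box seed -/

def AlienFree {G : Type} [AddCommGroup G] {N : ℕ} (s t u : Fin N → G) (P Q R : Finset (Fin N × Fin N)) : Prop :=
  ∀ a ∈ P, ∀ b ∈ Q, ∀ c ∈ R, (t b.2 - s b.1) + (u c.2 - t c.1) = u a.2 - s a.1 → a.1 = b.1 ∧ b.2 = c.1 ∧ a.2 = c.2

def Partitions {N B : ℕ} (P Q R : Fin B → Finset (Fin N × Fin N)) : Prop :=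
  ∀ i j k : Fin N, ∃! r : Fin B, (i, k) ∈ P r ∧ (i, j) ∈ Q r ∧ (j, k) ∈ R r

noncomputable def spectrum {G : Type} [AddCommGroup G] [DecidableEq G] {N B : ℕ} (s t u : Fin N → G)
    (P Q R : Fin B → Finset (Fin N × Fin N)) : Finset G :=
  Finset.univ.biUnion fun r : Fin B => ((P r) ×ˢ (Q r) ×ˢ (R r)).image
    (fun abc => (t abc.2.1.2 - s abc.2.1.1) + (u abc.2.2.2 - t abc.2.2.1) - (u abc.1.2 - s abc.1.1))

def IntSeed (d N B K E : ℕ) : Prop :=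
  ∃ (s t u : Fin N → (Fin d → ℤ)) (P Q R : Fin B → Finset (Fin N × Fin N)),
    (∀ r, AlienFree s t u (P r) (Q r) (R r)) ∧ Partitions P Q R ∧
    (spectrum s t u P Q R).card ≤ K ∧
    (∀ i l, |s i l| ≤ (E : ℤ) ∧ |t i l| ≤ (E : ℤ) ∧ |u i l| ≤ (E : ℤ))

/-- The singleton-box seed: `B = N³` boxes, one per cell, `d = 0` (all labels zero), spectrum `⊆ {0}`: `IntSeed 0 N (N^3) 1 0`.
Shows the definitions are inhabited in kind with `B·K = N³` (the trivial exponent 3). -/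
theorem intSeed_singletons (N : ℕ) : IntSeed 0 N (N ^ 3) 1 0 := by
  classical
  -- index the boxes by the cells
  have hcard : Fintype.card (Fin N × Fin N × Fin N) = N ^ 3 := by
    simp only [Fintype.card_prod, Fintype.card_fin]; ring
  let e : (Fin N × Fin N × Fin N) ≃ Fin (N ^ 3) := Fintype.equivFinOfCardEq hcard
  refine ⟨fun _ => 0, fun _ => 0, fun _ => 0,
    fun r => {((e.symm r).1, (e.symm r).2.2)}, fun r => {((e.symm r).1, (e.symm r).2.1)},
    fun r => {((e.symm r).2.1, (e.symm r).2.2)}, ?_, ?_, ?_, ?_⟩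
  · -- alien-free: the only triple of the box is its cell
    intro r a ha b hb c hc _
    simp only [Finset.mem_singleton] at ha hb hc
    subst ha; subst hb; subst hc
    exact ⟨rfl, rfl, rfl⟩
  · -- partition
    intro i j k
    refine ⟨e (i, j, k), ?_, ?_⟩
    · simp only [Equiv.symm_apply_apply, Finset.mem_singleton, and_self]
    · intro r hr
      simp only [Finset.mem_singleton, Prod.mk.injEq] at hr
      obtain ⟨⟨h1, h2⟩, ⟨-, h3⟩, -⟩ := hr
      have : e.symm r = (i, j, k) := Prod.ext h1.symm (Prod.ext h3.symm h2.symm)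
      rw [← this, Equiv.apply_symm_apply]
  · -- spectrum has at most one element: the label group `Fin 0 → ℤ` is a subsingleton
    exact Finset.card_le_one.mpr fun a _ b _ => Subsingleton.elim a b
  · intro i l; exact l.elim0

end Summit.MatrixMultiplication.MatrixMultiplication.Cruxes.Thesis.IntegerSeedFacts
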